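import Mathlib.Topology.Order.IntermediateValue
import Mathlib.Topology.MetricSpace.Bounded
import Mathlib.Topology.Instances.Real.Lemmas
import Mathlib.Analysis.Normed.Order.Lattice
import Mathlib.Topology.MetricSpace.ProperSpace.Real
import HarnessLib

/-!
# Components of a closed bounded subset of the line with finite frontier; separation of compact pieces

Topic `Probability/Percolation`.  Support file (proofs, no named fact) for the zone geometry of the
proof of Schramm–Smirnov's Prop. 4.1 (Ann. Probab. 39 (2011), §4), per-strip form: the pieces of
the cut between the junction squares are the images of the connected components of a closed set
of parameters, and two elementary facts make them usable:

* `exists_Icc_eq_connectedComponentIn` — a connected component of a closed bounded `F ⊆ ℝ` is a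
  closed interval `[a, b]` whose endpoints lie on the frontier of `F`; hence if the frontier is
  finite there are finitely many components (`finite_setOf_connectedComponentIn`);
* `exists_pos_forall_le_dist` — finitely many pairwise disjoint compact sets of a metric space are
  pairwise at distance at least some `g > 0`.

## References

* O. Schramm, S. Smirnov, Ann. Probab. 39 (2011), arXiv:1101.5820, §4, proof of Prop. 4.1 (the
  pieces of the cut between the discs). [SchrammSmirnov2011]
-/

noncomputable section

open Set Metric

namespace Literature.Probability.Percolation

namespace StripPieces

/-! ### Components of a closed bounded set of reals -/

/-- **A component of a closed bounded set of reals is a closed interval with endpoints on the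
frontier.** [folklore] -/
theorem exists_Icc_eq_connectedComponentIn {F : Set ℝ} (hF : IsClosed F) (hb : Bornology.IsBounded F) {x : ℝ}
    (hx : x ∈ F) : ∃ a b, a ≤ x ∧ x ≤ b ∧ connectedComponentIn F x = Icc a b ∧ a ∈ frontier F ∧ b ∈ frontier F := by
  set C := connectedComponentIn F x with hC
  have hCF : C ⊆ F := connectedComponentIn_subset F x
  have hxC : x ∈ C := mem_connectedComponentIn hx
  have hCconn : IsPreconnected C := isPreconnected_connectedComponentIn
  have hCord : OrdConnected C := isPreconnected_iff_ordConnected.1 hCconn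
  -- the closure of the component is inside it: the component is closed
  have hCcl : IsClosed C := by
    have hsub : closure C ⊆ C :=
      (isPreconnected_connectedComponentIn.closure).subset_connectedComponentIn (subset_closure hxC)
        ((closure_minimal hCF hF))
    exact closure_subset_iff_isClosed.1 hsub
  have hbC : Bornology.IsBounded C := hb.subset hCF
  have hbdd : BddBelow C ∧ BddAbove C := ⟨hbC.bddBelow, hbC.bddAbove⟩
  have hne : C.Nonempty := ⟨x, hxC⟩
  set a := sInf C with ha
  set b := sSup C with hb'
  have haC : a ∈ C := hCcl.csInf_mem hne hbdd.1
  have hbC' : b ∈ C := hCcl.csSup_mem hne hbdd.2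
  have hCeq : C = Icc a b := by
    refine Subset.antisymm (fun y hy => ⟨csInf_le hbdd.1 hy, le_csSup hbdd.2 hy⟩) (hCord.out haC hbC')
  -- endpoints are not interior points of `F`
  have frontier_of : ∀ {p : ℝ}, p ∈ C → (∀ ε > 0, ∃ q, q ∉ C ∧ dist q p < ε ∧ (Icc (min p q) (max p q) ⊆ F → False)) →
      p ∈ frontier F := by
    intro p hp hq
    rw [frontier, hF.closure_eq, mem_sdiff]
    refine ⟨hCF hp, fun hint => ?_⟩
    rw [mem_interior_iff_mem_nhds, Metric.mem_nhds_iff] at hint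
    obtain ⟨ε, hε, hball⟩ := hint
    obtain ⟨q, hqC, hqd, hcontra⟩ := hq ε hε
    apply hcontra
    intro r hr
    apply hball
    rw [Metric.mem_ball]
    simp only [mem_Icc, le_max_iff, min_le_iff] at hr
    rw [Real.dist_eq] at hqd ⊢
    rcases hr with ⟨h1, h2⟩
    rw [abs_lt] at hqd ⊢
    rcases h1 with h1 | h1 <;> rcases h2 with h2 | h2 <;> constructor <;> linarith
  have key : ∀ {p q : ℝ}, p ∈ C → Icc (min p q) (max p q) ⊆ F → q ∈ C := by
    intro p q hp hsub
    have hconn : IsPreconnected (Icc (min p q) (max p q)) := isPreconnected_Icc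
    have hpI : p ∈ Icc (min p q) (max p q) := ⟨min_le_left _ _, le_max_left _ _⟩
    have hqI : q ∈ Icc (min p q) (max p q) := ⟨min_le_right _ _, le_max_right _ _⟩
    have : Icc (min p q) (max p q) ⊆ connectedComponentIn F p := hconn.subset_connectedComponentIn hpI hsub
    rw [hC, connectedComponentIn_eq hp]
    exact this hqI
  refine ⟨a, b, csInf_le hbdd.1 hxC, le_csSup hbdd.2 hxC, hCeq, ?_, ?_⟩
  · refine frontier_of haC fun ε hε => ⟨a - ε / 2, fun h => ?_, ?_, fun hsub => ?_⟩
    · have := csInf_le hbdd.1 h; linarith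
    · rw [Real.dist_eq, show a - ε / 2 - a = -(ε / 2) by ring, abs_neg, abs_of_pos (by linarith)]; linarith
    · have := csInf_le hbdd.1 (key haC hsub); linarith
  · refine frontier_of hbC' fun ε hε => ⟨b + ε / 2, fun h => ?_, ?_, fun hsub => ?_⟩
    · have := le_csSup hbdd.2 h; linarith
    · rw [Real.dist_eq, show b + ε / 2 - b = ε / 2 by ring, abs_of_pos (by linarith)]; linarith
    · have := le_csSup hbdd.2 (key hbC' hsub); linarith

/-- **Finitely many components** when the frontier is finite. [folklore] -/
theorem finite_setOf_connectedComponentIn {F : Set ℝ} (hF : IsClosed F) (hb : Bornology.IsBounded F)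
    (hfr : (frontier F).Finite) : {C : Set ℝ | ∃ x ∈ F, C = connectedComponentIn F x}.Finite := by
  refine ((hfr.prod hfr).image fun p : ℝ × ℝ => Icc p.1 p.2).subset ?_
  rintro C ⟨x, hx, rfl⟩
  obtain ⟨a, b, -, -, hC, ha, hb'⟩ := exists_Icc_eq_connectedComponentIn hF hb hx
  exact ⟨(a, b), ⟨ha, hb'⟩, hC.symm⟩

/-- The components avoid a set of points off `F`; a component lies between two consecutive points of
a finite set of reals none of which is in `F`. [folklore] -/
theorem exists_between_of_Icc_subset {F : Set ℝ} {D : Finset ℝ} (hD : ∀ d ∈ D, d ∉ F) {a b : ℝ} (hab : a ≤ b)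
    (hsub : Icc a b ⊆ F) (hlo : ∃ d ∈ D, d ≤ a) (hhi : ∃ d ∈ D, b ≤ d) :
    ∃ s ∈ D, ∃ t ∈ D, s < a ∧ b < t ∧ ∀ u ∈ D, ¬ (s < u ∧ u < t) := by
  classical
  obtain ⟨s, hs, hsmax⟩ := (D.filter fun d => d ≤ a).exists_max_image id
    (by obtain ⟨d, hd, hda⟩ := hlo; exact ⟨d, Finset.mem_filter.2 ⟨hd, hda⟩⟩)
  obtain ⟨t, ht, htmin⟩ := (D.filter fun d => b ≤ d).exists_min_image id
    (by obtain ⟨d, hd, hdb⟩ := hhi; exact ⟨d, Finset.mem_filter.2 ⟨hd, hdb⟩⟩)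
  obtain ⟨hsD, hsa⟩ := Finset.mem_filter.1 hs
  obtain ⟨htD, hbt⟩ := Finset.mem_filter.1 ht
  have hsa' : s < a := lt_of_le_of_ne hsa fun h => hD s hsD (hsub ⟨h.ge, h ▸ hab⟩)
  have hbt' : b < t := lt_of_le_of_ne hbt fun h => hD t htD (hsub ⟨h ▸ hab, h.ge⟩)
  refine ⟨s, hsD, t, htD, hsa', hbt', fun u hu ⟨hsu, hut⟩ => ?_⟩
  by_cases hua : u ≤ a
  · have := hsmax u (Finset.mem_filter.2 ⟨hu, hua⟩); simp only [id] at this; linarith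
  · by_cases hub : b ≤ u
    · have := htmin u (Finset.mem_filter.2 ⟨hu, hub⟩); simp only [id] at this; linarith
    · push Not at hua hub
      exact hD u hu (hsub ⟨hua.le, hub.le⟩)

/-! ### Separation of finitely many disjoint compact sets -/

/-- Two disjoint nonempty compact sets of a metric space are at positive distance. [folklore] -/
theorem exists_pos_forall_le_dist_of_disjoint {X : Type*} [MetricSpace X] {A B : Set X} (hA : IsCompact A)
    (hB : IsCompact B) (hAB : Disjoint A B) : ∃ g > 0, ∀ x ∈ A, ∀ y ∈ B, g ≤ dist x y := by
  by_cases hAe : A.Nonempty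
  · by_cases hBe : B.Nonempty
    · obtain ⟨p, hp, hmin⟩ := (hA.prod hB).exists_isMinOn (hAe.prod hBe)
        (continuous_dist.comp (continuous_fst.prodMk continuous_snd)).continuousOn
      refine ⟨dist p.1 p.2, dist_pos.2 fun h => hAB.le_bot ⟨hp.1, h ▸ hp.2⟩, fun x hx y hy => ?_⟩
      exact hmin (show (x, y) ∈ A ×ˢ B from ⟨hx, hy⟩)
    · exact ⟨1, one_pos, fun x _ y hy => absurd ⟨y, hy⟩ hBe⟩
  · exact ⟨1, one_pos, fun x hx => absurd ⟨x, hx⟩ hAe⟩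

/-- **Finitely many pairwise disjoint compact sets are uniformly separated.** [folklore] -/
theorem exists_pos_forall_le_dist {X : Type*} [MetricSpace X] {N : ℕ} (P : Fin N → Set X)
    (hP : ∀ m, IsCompact (P m)) (hdisj : ∀ m m', m ≠ m' → Disjoint (P m) (P m')) :
    ∃ g > 0, ∀ m m', m ≠ m' → ∀ x ∈ P m, ∀ y ∈ P m', g ≤ dist x y := by
  classical
  -- a positive separation for each ordered pair
  have hpair : ∀ p : Fin N × Fin N, ∃ g > 0, p.1 ≠ p.2 → ∀ x ∈ P p.1, ∀ y ∈ P p.2, g ≤ dist x y := by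
    intro p
    by_cases h : p.1 = p.2
    · exact ⟨1, one_pos, fun h' => absurd h h'⟩
    · obtain ⟨g, hg, hgd⟩ := exists_pos_forall_le_dist_of_disjoint (hP p.1) (hP p.2) (hdisj _ _ h)
      exact ⟨g, hg, fun _ => hgd⟩
  choose g hg hgd using hpair
  by_cases hN : (Finset.univ : Finset (Fin N × Fin N)).Nonempty
  · refine ⟨Finset.univ.inf' hN g, ?_, fun m m' hne x hx y hy => ?_⟩
    · obtain ⟨p, -, hp⟩ := Finset.exists_mem_eq_inf' hN g
      rw [hp]; exact hg p
    · exact (Finset.inf'_le g (Finset.mem_univ (m, m'))).trans (hgd (m, m') hne x hx y hy)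
  · refine ⟨1, one_pos, fun m m' _ _ _ _ _ => absurd ⟨(m, m'), Finset.mem_univ _⟩ hN⟩

end StripPieces

end Literature.Probability.Percolation

end
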